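/-
Origin: expansion seat `planner-pub-hodgecm-pv06-g6-0`, handover #3 (HANDOVER 2026-08-18T13:24:16Z) md5 b2229bf661ebb143f28a80367e5020ad (412 l.); imports `Pv06g6.ArchCOrbitSmooth` (ONE rewrite -> `HodgeCM.PerL34.ArchCOrbitSmooth`, generic ^import Pv[0-9]+g[0-9]+\. rule) + tree HodgeCM.PerL34.ArchCFockAnalyticSmoke + Mathlib.Analysis.SpecialFunctions.ExpDeriv; land-after: #2 ArchCOrbitSmooth b12b3920 (after #1 ArchCOrbit e5dc59d7); as-landed = source with that  (`HOME/pub-hodgecm-pv06-g6/lean/Pv06g6/ArchCOrbitSmoke.lean`, md5 b2229bf6, 412 lines);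
landed by the gen-8 packager in gate run 30 as `HodgeCM/PerL34/ArchCOrbitSmoke.lean` (import ^import Pv06g6\.ArchCOrbitSmooth[ \t]*$→import HodgeCM.PerL34.ArchCOrbitSmooth ×1).
-/
/-
  HodgeCM/PerL34/ArchCOrbitSmoke.lean   (origin: pub-hodgecm-pv06-g6, WIP module `Pv06g6.ArchCOrbitSmoke`; session
  planner-pub-hodgecm-pv06-g6-0, DAG-NODE PROVER #06 gen 6; intended final place `HodgeCM/PerL34/ArchCOrbitSmoke.lean`,
  module `HodgeCM.PerL34.ArchCOrbitSmoke`; ONE import rewrite at intake: `import Pv06g6.ArchCOrbitSmooth` ↦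
  `import HodgeCM.PerL34.ArchCOrbitSmooth` (this seat's RUN-30 row #2); lands after rows #1, #2.  Nothing imports it.)

  # Seam S4 smoke: the D7-free records `OrbitCore`, `FockOrbitBridge`, `FockScalarBridge`, `FockSmoothBridge` are
  # inhabited — and the Fréchet-smooth-vector clause [SETUP D5′] is exercised with a NON-ZERO derivative

  PURPOSE (referee A's standing vacuity question, asked of every hypothesis record; companion of pv12-g3's
  `ArchCFockAnalyticSmoke`).  KIND: KERNEL smoke — asserts nothing, no axiom, no placeholder proof, standard axiom trio.

  §1  Over pv12-g3's LINEAR ONE-DIMENSIONAL TOY (`AnalyticSmoke.core/torus/pointed`: H = SK = ℂ, G = Unit, ω = id,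
      𝒯_Φ = Φ•id): the forgetful inhabitants `orbitBridgeOf` / `scalarBridgeOf` (through `FockOrbitBridge.ofAnalytic`,
      `FockScalarBridge.ofOrbit` from pv12-g3's `bridgeOf`), the generic `smoothBridgeOf pl ℓ …` (every field PROVED: with
      trivial ω the difference quotients vanish and `ℓ` kills the ladder slots), `orbitCoreOf` with a NON-VACUOUS `Eigen`
      witness, and the instances `Line.*` (κ-part a line) and `Mixed.*` (pv12's genuine raising operator on `ℂ[P]`,
      infinite-dimensional, non-trivial `gen`) with `H_occ_fires` through `FockSmoothBridge.H_occ`.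
      Honest scope, as pv12-g3's: JOINT SATISFIABILITY and typing coherence of the field lists; there the one-parameter
      curves are constant, so `smooth` / `hFpt` / `orbit_stable` are exercised only degenerately.
  §2  THE CIRCLE TOY (`CircleToy.core/torus/pointed`): H = HG = CG = SK = ℂ, **G = Circle** acting by ω(g)Φ = g·Φ on 𝒮
      and by R(g)v = g⁻¹·v on L² (unitary), so that the N21 invariance 𝒯_{ω(g)Φ}(R(g)v) = 𝒯_Φ(v) holds NON-TRIVIALLY;
      E^χ_f = f with f^{h} = h⁻¹f; one isotypic index.  Over it `CircleToy.smoothBridge : FockSmoothBridge` with the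
      one-parameter curve **e(s) = exp(is) ∈ Circle** (`Circle.exp`) and the real direction **X = i·id** on the κ-line:
      the [D5′] clause `smooth` is PROVED with NON-ZERO limit — s⁻¹(ω(e(s))Φ − ω(e(0))Φ) → iΦ in 𝒮 = ℂ
      (`tendsto_slope_coe_exp_mul`, from `HasDerivAt` of s ↦ e^{is}) — hence the derived scalar derivative `hFpt`
      (`FockSmoothBridge.toScalarBridge`, KERNEL) has the NON-ZERO value i at (φ⁰, v = 1) (`hFpt_value_ne_zero`), and the
      D7-free chart's `orbit_stable`, `Eigen`, `H_occ` all fire (`orbitCore_eigen`, `H_occ_fires`).  This certifies that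
      the scalar conventions of the ω-side clause [SETUP D5′] (real parameter, complex inverse, limit in the topology of
      𝒮^κ along `𝓝[≠] 0`) are the ones a genuine one-parameter group satisfies.
-/
import Summits.HodgeConjecture.HodgeCM.PerL34.ArchCOrbitSmooth_2
import Summits.HodgeConjecture.HodgeCM.PerL34.ArchCFockAnalyticSmoke_2
import Mathlib.Analysis.SpecialFunctions.ExpDeriv

set_option autoImplicit false

noncomputable section

open scoped Topology
open Filter

namespace HodgeCM
namespace PerL34
namespace ArchC
namespace OrbitSmoke

open HodgeCM.Prior.Perl34File HodgeCM.Prior.Perl34File.Perl34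

local notation "⟪" x ", " y "⟫" => @inner ℂ _ _ x y

/-! ## §1  Over pv12-g3's linear toy: the D7-free records are inhabited -/

section LinearToy

open AnalyticSmoke (core torus pointed TΦ_one_one R_apply)

variable (pl : Fock.FockPlaces) (ℓ : pl.F →ₗ[ℂ] ℂ) (hφ : ℓ pl.φ₀ ≠ 0)
  (hX : ∀ (k : pl.ιX) (φ : pl.F), ℓ (pl.X k φ) = 0)
  (hω : ∀ (t : pl.Tg) (φ : pl.F), ℓ (pl.ωT t φ) = ℓ φ) (hχ : ∀ t : pl.Tg, pl.χ t = 1)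

/-- `FockOrbitBridge` is inhabited over the linear toy (forgetfully from pv12-g3's `bridgeOf`). -/
def orbitBridgeOf : FockOrbitBridge core torus pointed :=
  FockOrbitBridge.ofAnalytic (AnalyticSmoke.bridgeOf pl ℓ hφ hX hω hχ)

/-- `FockScalarBridge` is inhabited over the linear toy. -/
def scalarBridgeOf : FockScalarBridge core torus pointed :=
  FockScalarBridge.ofOrbit (orbitBridgeOf pl ℓ hφ hX hω hχ)

/-- **`FockSmoothBridge` is inhabited over the linear toy**, for ANY Fock layer `pl` with a vacuum functional `ℓ`
(`ℓ φ⁰ ≠ 0`, `ℓ ∘ X_k = 0`, `ℓ ∘ ω_T(t) = ℓ`, trivial joint vacuum character): data as pv12-g3's `bridgeOf`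
(`ιT = 1`, `w = 1`, `ins f := ℓ`, `ιR := pl.ιX`, `XR := pl.X`, constant curves); the [D5′] clause `smooth` holds
because with ω = id the difference quotients vanish identically and `ℓ (X_k φ) = 0`.  Every field PROVED. -/
def smoothBridgeOf : FockSmoothBridge core torus pointed where
  pl := pl
  ιT := 1
  w := 1
  w_norm := fun t => by rw [MonoidHom.one_apply, norm_one]
  w_loc := fun t => by rw [MonoidHom.one_apply, inv_one]; exact hχ t
  TΦc_add := fun Φ Ψ => add_smul Φ Ψ (ContinuousLinearMap.id ℂ ℂ)
  TΦc_smul := fun c Φ => mul_smul c Φ (ContinuousLinearMap.id ℂ ℂ)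
  cont := fun p v => by
    show Continuous fun Φ : ℂ => Φ * v
    exact continuous_id.mul continuous_const
  FinIdx := Unit
  ins := fun _ => ℓ
  dense := (AnalyticSmoke.bridgeOf pl ℓ hφ hX hω hχ).dense
  omg_ins := fun _ t φ => by
    show ℓ φ = ℓ (pl.ωT t φ)
    rw [hω]
  invariance := fun _ _ _ => rfl
  ιR := pl.ιX
  XR := pl.X
  e := fun _ _ => ()
  ladder_span := fun k => Submodule.subset_span ⟨k, rfl⟩
  smooth := fun j f φ => by
    show Tendsto (fun s : ℝ => ((s : ℝ) : ℂ)⁻¹ • (ℓ φ - ℓ φ)) (𝓝[≠] 0) (𝓝 (ℓ (pl.X j φ)))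
    rw [hX, sub_self]
    simp only [smul_zero]
    exact tendsto_const_nhds
  wOccurs_of_eigenvector := fun _ _ => trivial

/-- (Ported verbatim from the HodgeCMPerL package; no docstring in the source.) -/
theorem smoothBridgeOf_pl : (smoothBridgeOf pl ℓ hφ hX hω hχ).pl = pl := rfl

/-- The D7-free chart over the linear toy. -/
def orbitCoreOf : OrbitCore core pointed := (smoothBridgeOf pl ℓ hφ hX hω hχ).toOrbitCore

/-- **Non-vacuity of the chart's eigenvector predicate**: `1 ∈ σ̂ = ⊤` is a non-zero joint `w`-eigenvector. -/
theorem orbitCoreOf_eigen : (orbitCoreOf pl ℓ hφ hX hω hχ).Eigen () :=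
  ⟨1, Submodule.mem_top, one_ne_zero, fun t => by
    show core.R ((1 : pl.Tg →* Unit) t) 1 = (1 : pl.Tg →* ℂ) t • (1 : ℂ)
    rw [R_apply, MonoidHom.one_apply, one_smul]⟩

include pl ℓ hφ hX hω hχ in
/-- N29's conclusion fires through `FockSmoothBridge.H_occ` on the NON-VACUOUS premise `𝒯_1 1 = 1 ≠ 0`. -/
theorem H_occ_of_smoothBridgeOf : torus.wOccurs () :=
  (smoothBridgeOf pl ℓ hφ hX hω hχ).H_occ 1 () ⟨1, Submodule.mem_top, by rw [TΦ_one_one]; exact one_ne_zero⟩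

/-! ### The line instance (pv12-g3 `AnalyticSmoke.Line`) -/

namespace Line

open AnalyticSmoke.Line (places ell ell_φ₀ ell_X ell_ωT χ_eq_one)

/-- (Ported verbatim from the HodgeCMPerL package; no docstring in the source.) -/
theorem ell_φ₀_ne_zero : ell places.φ₀ ≠ 0 := by rw [ell_φ₀]; exact one_ne_zero

/-- (Ported verbatim from the HodgeCMPerL package; no docstring in the source.) -/
def orbitBridge : FockOrbitBridge core torus pointed := orbitBridgeOf places ell ell_φ₀_ne_zero ell_X ell_ωT χ_eq_one

/-- (Ported verbatim from the HodgeCMPerL package; no docstring in the source.) -/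
def scalarBridge : FockScalarBridge core torus pointed :=
  scalarBridgeOf places ell ell_φ₀_ne_zero ell_X ell_ωT χ_eq_one

/-- (Ported verbatim from the HodgeCMPerL package; no docstring in the source.) -/
def smoothBridge : FockSmoothBridge core torus pointed :=
  smoothBridgeOf places ell ell_φ₀_ne_zero ell_X ell_ωT χ_eq_one

/-- (Ported verbatim from the HodgeCMPerL package; no docstring in the source.) -/
def orbitCore : OrbitCore core pointed := orbitCoreOf places ell ell_φ₀_ne_zero ell_X ell_ωT χ_eq_one

/-- (Ported verbatim from the HodgeCMPerL package; no docstring in the source.) -/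
theorem nonempty_orbitBridge : Nonempty (FockOrbitBridge core torus pointed) := ⟨orbitBridge⟩

/-- (Ported verbatim from the HodgeCMPerL package; no docstring in the source.) -/
theorem nonempty_scalarBridge : Nonempty (FockScalarBridge core torus pointed) := ⟨scalarBridge⟩

/-- (Ported verbatim from the HodgeCMPerL package; no docstring in the source.) -/
theorem nonempty_smoothBridge : Nonempty (FockSmoothBridge core torus pointed) := ⟨smoothBridge⟩

/-- (Ported verbatim from the HodgeCMPerL package; no docstring in the source.) -/
theorem nonempty_orbitCore : Nonempty (OrbitCore core pointed) := ⟨orbitCore⟩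

/-- (Ported verbatim from the HodgeCMPerL package; no docstring in the source.) -/
theorem orbitCore_eigen : orbitCore.Eigen () := orbitCoreOf_eigen places ell ell_φ₀_ne_zero ell_X ell_ωT χ_eq_one

example : smoothBridge.toOrbitCore.F = places.F := rfl

/-- (Ported verbatim from the HodgeCMPerL package; no docstring in the source.) -/
theorem H_occ_fires : torus.wOccurs () := H_occ_of_smoothBridgeOf places ell ell_φ₀_ne_zero ell_X ell_ωT χ_eq_one

end Line

/-! ### The instance with the GENUINE raising operator on `ℂ[P]` (pv12-g3 `AnalyticSmoke.Mixed`) -/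

namespace Mixed

open AnalyticSmoke.Mixed (places prodFn ellM ell_φ₀ ell_X ell_ωT χ_eq_one X_φ₀_ne_zero)

variable (cb : ℂ) (hcb : cb ≠ 0)

/-- (Ported verbatim from the HodgeCMPerL package; no docstring in the source.) -/
theorem ell_φ₀_ne_zero : prodFn cb hcb ellM (places cb hcb).φ₀ ≠ 0 := by rw [ell_φ₀]; exact one_ne_zero

/-- (Ported verbatim from the HodgeCMPerL package; no docstring in the source.) -/
def smoothBridge : FockSmoothBridge core torus pointed :=
  smoothBridgeOf (places cb hcb) (prodFn cb hcb ellM) (ell_φ₀_ne_zero cb hcb) (ell_X cb hcb) (ell_ωT cb hcb)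
    (χ_eq_one cb hcb)

/-- (Ported verbatim from the HodgeCMPerL package; no docstring in the source.) -/
def orbitCore : OrbitCore core pointed :=
  orbitCoreOf (places cb hcb) (prodFn cb hcb ellM) (ell_φ₀_ne_zero cb hcb) (ell_X cb hcb) (ell_ωT cb hcb)
    (χ_eq_one cb hcb)

include cb hcb in
/-- (Ported verbatim from the HodgeCMPerL package; no docstring in the source.) -/
theorem nonempty_smoothBridge : Nonempty (FockSmoothBridge core torus pointed) := ⟨smoothBridge cb hcb⟩

/-- The chart's ladder family is pv12's raising operator, NON-ZERO on φ⁰, and its `gen` is pv12's kernel theorem. -/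
theorem orbitCore_X_φ₀_ne_zero : (orbitCore cb hcb).X ⟨(), ()⟩ (places cb hcb).φ₀ ≠ 0 := X_φ₀_ne_zero cb hcb

/-- (Ported verbatim from the HodgeCMPerL package; no docstring in the source.) -/
theorem orbitCore_eigen : (orbitCore cb hcb).Eigen () :=
  orbitCoreOf_eigen (places cb hcb) (prodFn cb hcb ellM) (ell_φ₀_ne_zero cb hcb) (ell_X cb hcb) (ell_ωT cb hcb)
    (χ_eq_one cb hcb)

include cb hcb in
/-- (Ported verbatim from the HodgeCMPerL package; no docstring in the source.) -/
theorem H_occ_fires : torus.wOccurs () :=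
  H_occ_of_smoothBridgeOf (places cb hcb) (prodFn cb hcb ellM) (ell_φ₀_ne_zero cb hcb) (ell_X cb hcb) (ell_ωT cb hcb)
    (χ_eq_one cb hcb)

end Mixed

end LinearToy

/-! ## §2  The circle toy: `smooth`, `hFpt`, `orbit_stable` exercised with a NON-ZERO derivative -/

namespace CircleToy

/-- R(g) = g⁻¹ · id on L² = ℂ, as a monoid homomorphism `Circle →* (ℂ →L[ℂ] ℂ)`. -/
def Rop : Circle →* (ℂ →L[ℂ] ℂ) where
  toFun g := ((g⁻¹ : Circle) : ℂ) • ContinuousLinearMap.id ℂ ℂ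
  map_one' := ContinuousLinearMap.ext fun v => by
    show (((1 : Circle)⁻¹ : Circle) : ℂ) • v = v
    rw [inv_one, Circle.coe_one, one_smul]
  map_mul' g h := ContinuousLinearMap.ext fun v => by
    show (((g * h)⁻¹ : Circle) : ℂ) • v = ((g⁻¹ : Circle) : ℂ) • (((h⁻¹ : Circle) : ℂ) • v)
    rw [mul_inv_rev, Circle.coe_mul, mul_comm, mul_smul]

/-- (Ported verbatim from the HodgeCMPerL package; no docstring in the source.) -/
theorem Rop_apply (g : Circle) (v : ℂ) : Rop g v = ((g⁻¹ : Circle) : ℂ) * v := rfl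

/-- **The circle toy isolation core**: H = HG = CG = SK = ℂ, G = Circle, SigIdx = SigIdxG = Unit; R(g) = g⁻¹·id
(unitary), ω(g)Φ = g·Φ, 𝒯_Φ = Φ·id, σ̂ = τ̂ = ⊤, e_σ̂ = id. -/
def core : IsolationCore ℂ ℂ ℂ Circle ℂ Unit Unit where
  R := Rop
  R_unitary := fun g u v => by
    show ⟪((g⁻¹ : Circle) : ℂ) • u, ((g⁻¹ : Circle) : ℂ) • v⟫ = ⟪u, v⟫
    rw [inner_smul_left, inner_smul_right, ← mul_assoc, Complex.conj_mul', Circle.norm_coe]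
    simp
  omg := fun g s => (g : ℂ) * s
  TΦc := fun Φ => Φ • ContinuousLinearMap.id ℂ ℂ
  inclCG := ContinuousLinearMap.id ℂ ℂ
  hatσ := fun _ => ⊤
  hatσ_closed := by
    intro i
    rw [Submodule.top_coe]
    exact isClosed_univ
  hatσ_invariant := fun _ _ v _ => Submodule.mem_top
  hatσ_ortho := fun i j hij => absurd rfl hij
  hatσ_complete := by
    have h : (⨆ _ : Unit, (⊤ : Submodule ℂ ℂ)) = ⊤ := by simp
    rw [h]
    exact le_antisymm le_top (Submodule.le_topologicalClosure ⊤)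
  eσ := fun _ => ContinuousLinearMap.id ℂ ℂ
  eσ_mem := fun _ _ => Submodule.mem_top
  eσ_fix := fun _ _ _ => rfl
  eσ_selfAdjoint := fun _ _ _ => rfl
  AX9_espectral := fun _ _ _ _ v hv => hv
  hatτ := fun _ => ⊤
  hatτ_closed := by
    intro j
    rw [Submodule.top_coe]
    exact isClosed_univ
  hatτ_complete := by
    have h : (⨆ _ : Unit, (⊤ : Submodule ℂ ℂ)) = ⊤ := by simp
    rw [h]
    exact le_antisymm le_top (Submodule.le_topologicalClosure ⊤)

/-- (Ported verbatim from the HodgeCMPerL package; no docstring in the source.) -/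
theorem TΦc_apply (Φ v : ℂ) : core.TΦc Φ v = Φ * v := rfl

/-- (Ported verbatim from the HodgeCMPerL package; no docstring in the source.) -/
theorem TΦ_apply (Φ v : ℂ) : core.TΦ Φ v = Φ * v := rfl

/-- (Ported verbatim from the HodgeCMPerL package; no docstring in the source.) -/
theorem R_apply (g : Circle) (v : ℂ) : core.R g v = ((g⁻¹ : Circle) : ℂ) * v := rfl

/-- (Ported verbatim from the HodgeCMPerL package; no docstring in the source.) -/
theorem omg_apply (g : Circle) (Φ : ℂ) : core.omg g Φ = (g : ℂ) * Φ := rfl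

/-- **[NODE N21] holds NON-TRIVIALLY on the circle toy**: 𝒯_{ω(g)Φ}(R(g)v) = (gΦ)(g⁻¹v) = Φv = 𝒯_Φ(v). -/
theorem invariance (g : Circle) (Φ v : ℂ) : core.TΦc (core.omg g Φ) (core.R g v) = core.TΦc Φ v := by
  rw [TΦc_apply, TΦc_apply, omg_apply, R_apply, Circle.coe_inv, mul_mul_mul_comm,
    mul_inv_cancel₀ (Circle.coe_ne_zero g), one_mul]

/-- (Ported verbatim from the HodgeCMPerL package; no docstring in the source.) -/
theorem TΦ_one_one : core.TΦ 1 1 = 1 := by rw [TΦ_apply, mul_one]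

/-- The circle toy torus side: X = Unit, TestFn = ℂ, allowed ≡ True, ϑ_χ(Φ) = Φ, E^χ_f = f, f^{h} = h⁻¹f (so that
R(h)E^χ_f = E^χ_{f^h}), S₁₂ = ⊤, P_w = id, wOccurs ≡ True. -/
def torus : TorusData core where
  X := Unit
  TestFn := ℂ
  allowed := fun _ => True
  ϑc := fun _ Φ => Φ
  E := fun _ f => f
  S12 := ⊤
  S12_def := by
    symm
    apply SmokeS4.closure_span_eq_top_of_one_mem
    exact ⟨(), trivial, 1, rfl⟩
  wOccurs := fun _ => True
  Pw := ContinuousLinearMap.id ℂ ℂ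
  Pw_idem := ContinuousLinearMap.id_comp _
  Pw_selfAdjoint := fun _ _ => rfl
  AX5b_ϑ_cont := fun _ => continuous_id
  AX12_transl_cont := fun _ Φ => by
    show Continuous fun h : Circle => (h : ℂ) * Φ
    exact continuous_subtype_val.mul continuous_const
  ETransl := fun h _ f => ((h⁻¹ : Circle) : ℂ) • f
  AX12_E_transl := fun _ _ _ => rfl
  AX12_unfold_lift := fun Φ _ f => by
    show Φ * f ∈ (Submodule.span ℂ (Set.range fun h : Circle => (h : ℂ) * Φ)).topologicalClosure
    apply Submodule.le_topologicalClosure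
    have h1 : ((1 : Circle) : ℂ) * Φ ∈ Submodule.span ℂ (Set.range fun h : Circle => (h : ℂ) * Φ) :=
      Submodule.subset_span ⟨1, rfl⟩
    have h2 := Submodule.smul_mem _ f h1
    rwa [Circle.coe_one, one_mul, smul_eq_mul, mul_comm] at h2
  AX12_molly := fun _ Φ => subset_closure ⟨1, mul_one Φ⟩
  AX8_annihilation := by
    intro v hv
    simpa using hv () 1
  AX9_w_vector := fun M _ _ i _ hne => by
    obtain ⟨v, hv, hv0⟩ := (Submodule.ne_bot_iff _).mp hne
    exact ⟨v, hv, hv0, rfl⟩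

/-- The circle toy point structure: one point, evaluation = id. -/
def pointed : C4a.PointedCore core where
  Pt := Unit
  evalPt := fun _ => ContinuousLinearMap.id ℂ ℂ
  evalPt_sep := fun _ h => h ()

/-- (Ported verbatim from the HodgeCMPerL package; no docstring in the source.) -/
theorem evalPt_apply (p : Unit) (z : ℂ) : pointed.evalPt p z = z := rfl

/-- **The one-parameter group e(s) = e^{is} differentiates**: s ↦ e(s)·c has derivative i·c at 0. -/
theorem hasDerivAt_coe_exp_mul (c : ℂ) : HasDerivAt (fun s : ℝ => (Circle.exp s : ℂ) * c) (Complex.I * c) 0 := by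
  have h1 := (((Complex.ofRealCLM.hasDerivAt (x := (0 : ℝ))).mul_const Complex.I).cexp).mul_const c
  refine (h1.congr_deriv ?_).congr_of_eventuallyEq (Eventually.of_forall fun s => ?_)
  · simp [Complex.ofRealCLM_apply]
  · simp [Circle.coe_exp, Complex.ofRealCLM_apply]

/-- The same in the difference-quotient form of `FockSmoothBridge.smooth` ([SETUP D5′]): s⁻¹(e(s)c − e(0)c) → i·c. -/
theorem tendsto_slope_coe_exp_mul (c : ℂ) :
    Tendsto (fun s : ℝ => ((s : ℝ) : ℂ)⁻¹ • ((Circle.exp s : ℂ) * c - (Circle.exp 0 : ℂ) * c)) (𝓝[≠] 0)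
      (𝓝 (Complex.I * c)) := by
  have h := hasDerivAt_coe_exp_mul c
  rw [hasDerivAt_iff_tendsto_slope] at h
  refine h.congr' (Eventually.of_forall fun s => ?_)
  show slope (fun s : ℝ => (Circle.exp s : ℂ) * c) 0 s =
    ((s : ℝ) : ℂ)⁻¹ • ((Circle.exp s : ℂ) * c - (Circle.exp 0 : ℂ) * c)
  rw [slope_def_module, sub_zero, Complex.real_smul, Complex.ofReal_inv, smul_eq_mul]

open AnalyticSmoke.Line (places ell ell_φ₀ ell_ωT χ_eq_one φ₀_ne_zero)


-- port_pkg: scope closed for this part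
end CircleToy
end OrbitSmoke
end ArchC
end PerL34
end HodgeCM
end
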